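import Mathlib
import Summits.ValiantsHypothesis.ValiantsHypothesis.Theorems.LacunarySymmetroidMatrixDescartesCensusWindowFourWitnessMult

/-!
# `MatrixDescartes` census — WINDOW-4 RIGHT witness rows WITH MULTIPLICITY

HONEST FRAMING.  Object-search cell `pub-symmetroid`, door-A target `DoorA26 := PosRootLawAt 2 6 19`
(stmt-ValiantsHypothesis-19979; OPEN, typed, never asserted).  Mirror of `…CensusWindowFourWitnessMult` (engine-2 g30) for the RIGHT
centre witness of val-sym-door-p1 g9 (`r` at or right of the common centre `m` of `T₂` and `Φ`, `T₂(r) > 0`, `Φ(r) < 0`): the window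
4-nomial `g = a − b x^u + c x^(u+v) − e x^(u+v+w)` then has at most two positive roots COUNTED WITH MULTIPLICITY.

* `fourNomial_rootMultiplicity_le_one_of_right_centre_witness` — every positive root is simple.  At a multiple root `x`: `Φ(x) = 0`,
  `T₂(x) = 0`.  `x ≥ r`: `T₂` monotone on `[m, ∞)` gives `T₂(x) ≥ T₂(r) > 0`.  `m ≤ x < r`: `Φ` monotone on `[m, ∞)` gives
  `Φ(r) ≥ Φ(x) = 0`.  `x < m`: `Φ ≤ 0` on `[x, r]` (antitone down from `Φ(x) = 0` on `[x, m]`, `≤ Φ(r) < 0` on `[m, r]`), so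
  `ψ = g / x^u` (`ψ′ = −Φ/x^(u+1)`) is non-decreasing on `[x, r]` and `0 = ψ(x) ≤ ψ(r) = g(r)/r^u`; but `u·g(r) = Φ(r) − r^u T₂(r) < 0`.
* `fourNomial_countP_posRoots_le_two_of_right_centre_witness`, `fourNomial_countP_posRoots_le_two_of_right_param` — the multiplicity
  forms of p570164 / p571759 (right side; hypotheses verbatim, plus `0 < c`).

Nothing here bounds any census count; `DoorA26` OPEN; nothing on `MatrixDescartes` (stmt-ValiantsHypothesis-18050) or `VP ≠ VNP`.

[folklore] Rolle with multiplicity for a one-variable fewnomial; elementary.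
-/

-- `Summit.ValiantsHypothesis.ValiantsHypothesis.…` repeats a component by the D-0017 layout
-- (single-conjunct summit), which the `dupNamespace` linter flags; the name is mandated.
set_option linter.dupNamespace false

namespace Summit.ValiantsHypothesis.ValiantsHypothesis.Theorems.LacunarySymmetroidMatrixDescartes.Census

open Polynomial Finset Set
open scoped BigOperators Polynomial

/-- Algebraic form of `(g · y^(−u))′`: `g′·(y^u)⁻¹ + g·(−(u y^(u−1))/(y^u)²) = (y g′ − u g)·y^(u−1)/(y^u)²` (`y ≠ 0`, `u ≥ 1`). [folklore] -/
theorem deriv_mul_inv_pow_identity (A G y : ℝ) {u : ℕ} (hu : 0 < u) (hy : y ≠ 0) :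
    A * (y ^ u)⁻¹ + G * (-((u : ℝ) * y ^ (u - 1)) / (y ^ u) ^ 2) = (y * A - (u : ℝ) * G) * y ^ (u - 1) / (y ^ u) ^ 2 := by
  have hpow : y ^ u = y ^ (u - 1) * y := by rw [← pow_succ, Nat.sub_add_cancel hu]
  have hq : y ^ (u - 1) ≠ 0 := pow_ne_zero _ hy
  rw [hpow]
  field_simp
  ring

/-- **Under the RIGHT CENTRE WITNESS every positive root of the window 4-nomial is SIMPLE.**  `0 < r` at or right of the common centre
(`v(u+v)·c ≤ (v+w)(u+v+w)·e·r^w`), `T₂(r) > 0`, `Φ(r) < 0` (`c, e > 0`). [folklore] -/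
theorem fourNomial_rootMultiplicity_le_one_of_right_centre_witness {u v w : ℕ} (hu : 0 < u) (hv : 0 < v) (hw : 0 < w)
    {a b c e : ℝ} (hc : 0 < c) (he : 0 < e) {r : ℝ} (hr : 0 < r)
    (hcen : (v : ℝ) * ((u : ℝ) + v) * c ≤ ((v : ℝ) + w) * ((u : ℝ) + v + w) * e * r ^ w)
    (hT₂r : 0 < (u : ℝ) * b - ((u : ℝ) + v) * c * r ^ v + ((u : ℝ) + v + w) * e * r ^ (v + w))
    (hΦr : (u : ℝ) * a - (v : ℝ) * c * r ^ (u + v) + ((v : ℝ) + w) * e * r ^ (u + v + w) < 0)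
    {x : ℝ} (hx : 0 < x) (hroot : (C a - C b * X ^ u + C c * X ^ (u + v) - C e * X ^ (u + v + w)).IsRoot x) :
    (C a - C b * X ^ u + C c * X ^ (u + v) - C e * X ^ (u + v + w)).rootMultiplicity x ≤ 1 := by
  set P : ℝ[X] := C a - C b * X ^ u + C c * X ^ (u + v) - C e * X ^ (u + v + w) with hPdef
  -- the common centre m and the monotonicity facts (small context first)
  have hden : 0 < ((v : ℝ) + w) * ((u : ℝ) + v + w) * e := by positivity
  obtain ⟨m, hm, hmw⟩ := exists_pos_pow_eq (show 0 < (v : ℝ) * ((u : ℝ) + v) * c / (((v : ℝ) + w) * ((u : ℝ) + v + w) * e)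
    by positivity) hw
  have hmeq : ((v : ℝ) + w) * ((u : ℝ) + v + w) * e * m ^ w = (v : ℝ) * ((u : ℝ) + v) * c := by
    rw [hmw]; field_simp
  have hmr : m ≤ r := by
    have hpw : m ^ w ≤ r ^ w := by
      have := hcen; rw [← hmeq] at this
      exact le_of_mul_le_mul_left this hden
    exact le_of_pow_le_pow_left₀ hw.ne' hr.le hpw
  have hqp : v + w - v = w := by omega
  have hqp' : u + v + w - (u + v) = w := by omega
  have hcenT : (v : ℝ) * (((u : ℝ) + v) * c) ≤ (((v + w : ℕ)) : ℝ) * (((u : ℝ) + v + w) * e) * m ^ (v + w - v) := by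
    rw [hqp]; push_cast; have h' := hmeq; ring_nf at h' ⊢; linarith
  have hmonoT := trinomial_monotoneOn_Ici (α := (u : ℝ) * b) (β := ((u : ℝ) + v) * c) (γ := ((u : ℝ) + v + w) * e)
    (p := v) (q := v + w) (r := m) hv (by omega) (by positivity) hm hcenT
  have hcenΦ1 : (((u + v + w : ℕ)) : ℝ) * (((v : ℝ) + w) * e) * m ^ (u + v + w - (u + v)) ≤ (((u + v : ℕ)) : ℝ) * ((v : ℝ) * c) := by
    rw [hqp']; push_cast; have h' := hmeq; ring_nf at h' ⊢; linarith
  have hcenΦ2 : (((u + v : ℕ)) : ℝ) * ((v : ℝ) * c) ≤ (((u + v + w : ℕ)) : ℝ) * (((v : ℝ) + w) * e) * m ^ (u + v + w - (u + v)) := by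
    rw [hqp']; push_cast; have h' := hmeq; ring_nf at h' ⊢; linarith
  have hantiΦ := trinomial_antitoneOn_Icc (α := (u : ℝ) * a) (β := (v : ℝ) * c) (γ := ((v : ℝ) + w) * e)
    (p := u + v) (q := u + v + w) (r := m) (Nat.add_pos_left hu v) (by omega) (by positivity) hcenΦ1
  have hmonoΦ := trinomial_monotoneOn_Ici (α := (u : ℝ) * a) (β := (v : ℝ) * c) (γ := ((v : ℝ) + w) * e)
    (p := u + v) (q := u + v + w) (r := m) (Nat.add_pos_left hu v) (by omega) (by positivity) hm hcenΦ2
  -- g(r) < 0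
  have hru : 0 < r ^ u := pow_pos hr u
  have hgr : a - b * r ^ u + c * r ^ (u + v) - e * r ^ (u + v + w) < 0 := by
    have hpw1 : r ^ (u + v) = r ^ u * r ^ v := pow_add r u v
    have hpw2 : r ^ (u + v + w) = r ^ u * r ^ (v + w) := by rw [add_assoc, pow_add]
    have hid : (u : ℝ) * (a - b * r ^ u + c * r ^ (u + v) - e * r ^ (u + v + w))
        = ((u : ℝ) * a - (v : ℝ) * c * r ^ (u + v) + ((v : ℝ) + w) * e * r ^ (u + v + w))
          - r ^ u * ((u : ℝ) * b - ((u : ℝ) + v) * c * r ^ v + ((u : ℝ) + v + w) * e * r ^ (v + w)) := by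
      rw [hpw1, hpw2]; ring
    have hneg : (u : ℝ) * (a - b * r ^ u + c * r ^ (u + v) - e * r ^ (u + v + w)) < 0 := by
      have hm' : 0 < r ^ u * ((u : ℝ) * b - ((u : ℝ) + v) * c * r ^ v + ((u : ℝ) + v + w) * e * r ^ (v + w)) :=
        mul_pos hru hT₂r
      rw [hid]; linarith
    have hu' : (0 : ℝ) < u := by exact_mod_cast hu
    by_contra hge
    have : 0 ≤ (u : ℝ) * (a - b * r ^ u + c * r ^ (u + v) - e * r ^ (u + v + w)) := mul_nonneg hu'.le (not_lt.mp hge)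
    linarith
  -- a multiple root x: g(x) = g'(x) = 0, hence Φ(x) = 0 and T₂(x) = 0
  by_contra hmul
  have h2 : 1 < P.rootMultiplicity x := by omega
  have hg0 : a - b * x ^ u + c * x ^ (u + v) - e * x ^ (u + v + w) = 0 := by
    have := hroot; rw [IsRoot.def, hPdef, eval_fourNomial] at this; exact this
  have hd0 : (derivative P).eval x = 0 := by
    have := isRoot_iterate_derivative_of_lt_rootMultiplicity h2
    simpa using this
  have hxd : x * (derivative P).eval x
      = -(b * (u : ℝ) * x ^ u) + c * ((u : ℝ) + v) * x ^ (u + v) - e * ((u : ℝ) + v + w) * x ^ (u + v + w) := by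
    rw [hPdef]; exact mul_eval_derivative_fourNomial a b c e u v w x
  rw [hd0, mul_zero] at hxd
  have hxu : 0 < x ^ u := pow_pos hx u
  have hΦx : (u : ℝ) * a - (v : ℝ) * c * x ^ (u + v) + ((v : ℝ) + w) * e * x ^ (u + v + w) = 0 := by
    linear_combination (u : ℝ) * hg0 + hxd
  have hT₂x : (u : ℝ) * b - ((u : ℝ) + v) * c * x ^ v + ((u : ℝ) + v + w) * e * x ^ (v + w) = 0 := by
    have hpw1 : x ^ (u + v) = x ^ u * x ^ v := pow_add x u v
    have hpw2 : x ^ (u + v + w) = x ^ u * x ^ (v + w) := by rw [add_assoc, pow_add]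
    have hprod : x ^ u * ((u : ℝ) * b - ((u : ℝ) + v) * c * x ^ v + ((u : ℝ) + v + w) * e * x ^ (v + w)) = 0 := by
      rw [hpw1, hpw2] at hxd; linarith
    rcases mul_eq_zero.mp hprod with h0 | h0
    · exact absurd h0 hxu.ne'
    · exact h0
  rcases le_or_gt r x with hxr | hxr
  · -- r ≤ x : T₂ monotone on [m, ∞) gives T₂(x) ≥ T₂(r) > 0
    have hle := hmonoT (show r ∈ Ici m from hmr) (show x ∈ Ici m from hmr.trans hxr) hxr
    have : (u : ℝ) * b - ((u : ℝ) + v) * c * r ^ v + ((u : ℝ) + v + w) * e * r ^ (v + w)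
        ≤ (u : ℝ) * b - ((u : ℝ) + v) * c * x ^ v + ((u : ℝ) + v + w) * e * x ^ (v + w) := hle
    linarith
  · rcases le_or_gt m x with hmx | hmx
    · -- m ≤ x < r : Φ monotone on [m, ∞) gives Φ(r) ≥ Φ(x) = 0
      have hle := hmonoΦ (show x ∈ Ici m from hmx) (show r ∈ Ici m from hmr) hxr.le
      have : (u : ℝ) * a - (v : ℝ) * c * x ^ (u + v) + ((v : ℝ) + w) * e * x ^ (u + v + w)
          ≤ (u : ℝ) * a - (v : ℝ) * c * r ^ (u + v) + ((v : ℝ) + w) * e * r ^ (u + v + w) := hle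
      linarith
    · -- x < m : Φ ≤ 0 on [x, r], so ψ = g / y^u is non-decreasing on [x, r]; 0 = ψ(x) ≤ ψ(r) < 0
      have hΦle : ∀ y ∈ Icc x r,
          (u : ℝ) * a - (v : ℝ) * c * y ^ (u + v) + ((v : ℝ) + w) * e * y ^ (u + v + w) ≤ 0 := by
        intro y hy
        rcases le_or_gt y m with hym | hym
        · have hle := hantiΦ (show x ∈ Icc (0 : ℝ) m from ⟨hx.le, hmx.le⟩) (show y ∈ Icc (0 : ℝ) m from ⟨hx.le.trans hy.1, hym⟩) hy.1
          have : (u : ℝ) * a - (v : ℝ) * c * y ^ (u + v) + ((v : ℝ) + w) * e * y ^ (u + v + w)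
              ≤ (u : ℝ) * a - (v : ℝ) * c * x ^ (u + v) + ((v : ℝ) + w) * e * x ^ (u + v + w) := hle
          linarith
        · have hle := hmonoΦ (show y ∈ Ici m from hym.le) (show r ∈ Ici m from hmr) hy.2
          have : (u : ℝ) * a - (v : ℝ) * c * y ^ (u + v) + ((v : ℝ) + w) * e * y ^ (u + v + w)
              ≤ (u : ℝ) * a - (v : ℝ) * c * r ^ (u + v) + ((v : ℝ) + w) * e * r ^ (u + v + w) := hle
          linarith
      have hmono : MonotoneOn (fun y : ℝ => P.eval y * (y ^ u)⁻¹) (Icc x r) := by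
        have hpos : ∀ y ∈ Icc x r, 0 < y := fun y hy => hx.trans_le hy.1
        apply monotoneOn_of_deriv_nonneg (convex_Icc x r)
        · exact (P.continuous.continuousOn).mul
            ((continuousOn_pow u).inv₀ (fun y hy => pow_ne_zero _ (hpos y hy).ne'))
        · intro y hy
          rw [interior_Icc] at hy
          have hy0 : 0 < y := hx.trans hy.1
          exact ((P.differentiableAt).mul ((differentiableAt_pow u).inv (pow_ne_zero _ hy0.ne'))).differentiableWithinAt
        · intro y hy
          rw [interior_Icc] at hy
          have hy0 : 0 < y := hx.trans hy.1
          have hyu : 0 < y ^ u := pow_pos hy0 u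
          have hder : HasDerivAt (fun y : ℝ => P.eval y * (y ^ u)⁻¹)
              ((derivative P).eval y * (y ^ u)⁻¹ + P.eval y * (-((u : ℝ) * y ^ (u - 1)) / (y ^ u) ^ 2)) y :=
            (P.hasDerivAt y).mul ((hasDerivAt_pow u y).inv (pow_ne_zero _ hy0.ne'))
          rw [hder.deriv]
          have hyd : y * (derivative P).eval y
              = -(b * (u : ℝ) * y ^ u) + c * ((u : ℝ) + v) * y ^ (u + v) - e * ((u : ℝ) + v + w) * y ^ (u + v + w) := by
            rw [hPdef]; exact mul_eval_derivative_fourNomial a b c e u v w y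
          have hPy : P.eval y = a - b * y ^ u + c * y ^ (u + v) - e * y ^ (u + v + w) := by rw [hPdef, eval_fourNomial]
          -- y·P'(y) − u·P(y) = −Φ(y) ≥ 0
          have hΦy := hΦle y ⟨hy.1.le, hy.2.le⟩
          have hkey : 0 ≤ y * (derivative P).eval y - (u : ℝ) * P.eval y := by
            have hid' : y * (derivative P).eval y - (u : ℝ) * P.eval y
                = -((u : ℝ) * a - (v : ℝ) * c * y ^ (u + v) + ((v : ℝ) + w) * e * y ^ (u + v + w)) := by
              rw [hyd, hPy]; ring
            rw [hid']; linarith [hΦy]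
          -- the derivative equals (y P' − u P) · y^(u−1) / (y^u)^2
          rw [deriv_mul_inv_pow_identity _ _ _ hu hy0.ne']
          apply div_nonneg (mul_nonneg hkey (pow_pos hy0 _).le) (sq_nonneg _)
      have hle := hmono ⟨le_rfl, hxr.le⟩ ⟨hxr.le, le_rfl⟩ hxr.le
      have hPx : P.eval x = 0 := by rw [hPdef, eval_fourNomial]; exact hg0
      have hPr : P.eval r = a - b * r ^ u + c * r ^ (u + v) - e * r ^ (u + v + w) := by rw [hPdef, eval_fourNomial]
      have h1 : P.eval x * (x ^ u)⁻¹ ≤ P.eval r * (r ^ u)⁻¹ := hle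
      rw [hPx, zero_mul, hPr] at h1
      have hinv : 0 < (r ^ u)⁻¹ := inv_pos.mpr hru
      have : (a - b * r ^ u + c * r ^ (u + v) - e * r ^ (u + v + w)) * (r ^ u)⁻¹ < 0 := mul_neg_of_neg_of_pos hgr hinv
      linarith

/-- **WINDOW-4 RIGHT CENTRE-WITNESS ROW, WITH MULTIPLICITY.** [folklore] -/
theorem fourNomial_countP_posRoots_le_two_of_right_centre_witness {u v w : ℕ} (hu : 0 < u) (hv : 0 < v) (hw : 0 < w)
    {a b c e : ℝ} (ha : 0 < a) (hb : 0 < b) (hc : 0 < c) (he : 0 < e) {r : ℝ} (hr : 0 < r)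
    (hcen : (v : ℝ) * ((u : ℝ) + v) * c ≤ ((v : ℝ) + w) * ((u : ℝ) + v + w) * e * r ^ w)
    (hT₂r : 0 < (u : ℝ) * b - ((u : ℝ) + v) * c * r ^ v + ((u : ℝ) + v + w) * e * r ^ (v + w))
    (hΦr : (u : ℝ) * a - (v : ℝ) * c * r ^ (u + v) + ((v : ℝ) + w) * e * r ^ (u + v + w) < 0) :
    (C a - C b * X ^ u + C c * X ^ (u + v) - C e * X ^ (u + v + w)).roots.countP (fun x => 0 < x) ≤ 2 := by
  refine le_trans (countP_posRoots_le_card_posRoots_of_rootMultiplicity_le_one _ ?_)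
    (fourNomial_card_posRoots_le_two_of_right_centre_witness hu hv hw ha hb he hr hcen hT₂r hΦr)
  intro x hx hroot
  exact fourNomial_rootMultiplicity_le_one_of_right_centre_witness hu hv hw hc he hr hcen hT₂r hΦr hx hroot

/-- **WINDOW-4 PARAMETRIC RIGHT ROW, WITH MULTIPLICITY.**  Hypotheses verbatim those of
`fourNomial_card_posRoots_le_two_of_right_param`; conclusion with `roots.countP`. [folklore] -/
theorem fourNomial_countP_posRoots_le_two_of_right_param {u v w : ℕ} (hu : 0 < u) (hv : 0 < v) (hw : 0 < w)
    {a b c e mu t : ℝ} (ha : 0 < a) (hb : 0 < b) (hc : 0 < c) (he : 0 < e) (hmu : 1 ≤ mu) (ht : 0 < t)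
    (hmut : mu * ((u : ℝ) + v) + t * ((u : ℝ) + v + w) < (u : ℝ) + v + w) {ρ : ℝ} (hρ : 0 < ρ)
    (hρdef : ρ * (((v : ℝ) + w) * ((u : ℝ) + v + w) * e) = mu * ((v : ℝ) * ((u : ℝ) + v) * c))
    (h2 : (((u : ℝ) + v) * c) ^ w * ρ ^ v < ((u : ℝ) * b) ^ w)
    (h3 : ((u : ℝ) * a) ^ w ≤ (t * ((v : ℝ) * c)) ^ w * ρ ^ (u + v)) :
    (C a - C b * X ^ u + C c * X ^ (u + v) - C e * X ^ (u + v + w)).roots.countP (fun x => 0 < x) ≤ 2 := by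
  obtain ⟨r, hr, hrw⟩ := exists_pos_pow_eq hρ hw
  have hwne : w ≠ 0 := hw.ne'
  have hrv : (r ^ v) ^ w = ρ ^ v := by rw [← pow_mul, mul_comm, pow_mul, hrw]
  have hruv : (r ^ (u + v)) ^ w = ρ ^ (u + v) := by rw [← pow_mul, mul_comm, pow_mul, hrw]
  have hkey : ((v : ℝ) + w) * ((u : ℝ) + v + w) * e * r ^ w = mu * ((v : ℝ) * ((u : ℝ) + v) * c) := by
    rw [hrw, mul_comm, hρdef]
  have hcen : (v : ℝ) * ((u : ℝ) + v) * c ≤ ((v : ℝ) + w) * ((u : ℝ) + v + w) * e * r ^ w := by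
    rw [hkey]
    have h0 : 0 ≤ (v : ℝ) * ((u : ℝ) + v) * c := by positivity
    nlinarith
  have hT : 0 < (u : ℝ) * b - ((u : ℝ) + v) * c * r ^ v + ((u : ℝ) + v + w) * e * r ^ (v + w) := by
    have hlt : ((u : ℝ) + v) * c * r ^ v < (u : ℝ) * b := by
      refine lt_of_pow_lt_pow_left' (by positivity) w ?_
      calc (((u : ℝ) + v) * c * r ^ v) ^ w = (((u : ℝ) + v) * c) ^ w * ρ ^ v := by rw [mul_pow, hrv]
        _ < ((u : ℝ) * b) ^ w := h2
    have hpos : 0 < ((u : ℝ) + v + w) * e * r ^ (v + w) := by positivity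
    linarith
  have hΦ : (u : ℝ) * a - (v : ℝ) * c * r ^ (u + v) + ((v : ℝ) + w) * e * r ^ (u + v + w) < 0 := by
    have hle : (u : ℝ) * a ≤ t * ((v : ℝ) * c) * r ^ (u + v) := by
      have hx : 0 ≤ (u : ℝ) * a := by positivity
      have hy : 0 ≤ t * ((v : ℝ) * c) * r ^ (u + v) := by positivity
      refine le_of_pow_le_pow_left' hx hy hwne ?_
      calc ((u : ℝ) * a) ^ w ≤ (t * ((v : ℝ) * c)) ^ w * ρ ^ (u + v) := h3
        _ = (t * ((v : ℝ) * c) * r ^ (u + v)) ^ w := by rw [← hruv, ← mul_pow]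
    have hsplit : ((v : ℝ) + w) * e * r ^ (u + v + w)
        = (((v : ℝ) + w) * ((u : ℝ) + v + w) * e * r ^ w) * r ^ (u + v) / ((u : ℝ) + v + w) := by
      have hU : ((u : ℝ) + v + w) ≠ 0 := by positivity
      field_simp
      ring
    rw [hsplit, hkey]
    have hruvpos : 0 < r ^ (u + v) := by positivity
    have hvc : 0 < (v : ℝ) * c := by positivity
    have hU : 0 < (u : ℝ) + v + w := by positivity
    have hcoef : mu * ((u : ℝ) + v) / ((u : ℝ) + v + w) + t < 1 := by
      rw [div_add' _ _ _ hU.ne', div_lt_one hU]; linarith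
    have : (u : ℝ) * a - (v : ℝ) * c * r ^ (u + v)
        + mu * ((v : ℝ) * ((u : ℝ) + v) * c) * r ^ (u + v) / ((u : ℝ) + v + w)
        ≤ ((v : ℝ) * c * r ^ (u + v)) * (t - 1 + mu * ((u : ℝ) + v) / ((u : ℝ) + v + w)) := by
      have hexp : ((v : ℝ) * c * r ^ (u + v)) * (t - 1 + mu * ((u : ℝ) + v) / ((u : ℝ) + v + w))
          = t * ((v : ℝ) * c) * r ^ (u + v) - (v : ℝ) * c * r ^ (u + v)
            + mu * ((v : ℝ) * ((u : ℝ) + v) * c) * r ^ (u + v) / ((u : ℝ) + v + w) := by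
        field_simp
      rw [hexp]; linarith
    have hneg : ((v : ℝ) * c * r ^ (u + v)) * (t - 1 + mu * ((u : ℝ) + v) / ((u : ℝ) + v + w)) < 0 := by
      apply mul_neg_of_pos_of_neg (by positivity)
      linarith
    linarith
  exact fourNomial_countP_posRoots_le_two_of_right_centre_witness hu hv hw ha hb hc he hr hcen hT hΦ

end Summit.ValiantsHypothesis.ValiantsHypothesis.Theorems.LacunarySymmetroidMatrixDescartes.Census
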